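/-
Copyright (c) 2026 the pub-hodgecm-mathlib formalisation cell (harness21).  Prover seat hodgecm-mathlib-K2E3-p34 (g0), HCML Track B «K2-LIT» (close-out strike line L4
`stub_StCharTS`), h413 = `stmt-HodgeConjecture-24833`, line `K2_E3_EllipticInputs`, PART «SC» socket (SC-an)₂ `sig_K2E3SupercuspidalTruncatedCharAnalyticTwo`, the (M5h₂)
chain (dealer K2E3-plan (g4) 2026-09-04T14:56:54Z «p34 takes the first leaf of `K2E3SupercuspBallBoundSplitAssemblyTwo`»): the `U(1,1)` twin (D2)₂ of ★ p856791
`K2E3ConjugatorHeightControlRankOne` (K2E3-p21 (g3)) — HARISH-CHANDRA'S THEOREM 18 + COROLLARY AT RANK ONE FOR THE DIAGONAL TORUS OF `U(σ, Φ₂)(K)`, by spectral projectors.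
2026-09-04.
-/
import Summits.HodgeConjecture.HodgeConjecture.Theorems.K2E3ConjugatorHeightControlRankOne   -- ★ p856791 (K2E3-p21) (D2) at `Φ₃`: its RANK-FREE §1 (`v_pow_mul_le_one_of_eigen`, `mul_diagonal_mul_apply_of_support`, `v_pow_mul_sub_smul_apply_le_one`) is REUSED BY NAME; brings ★ p856390 `K2E3HeightBallExhaustion`, ★ U3Torus `coe_inv_glDiagonal`, ★ `torusU_mul_comm`, ★ `CartanUnique`
import Summits.HodgeConjecture.HodgeConjecture.Theorems.K2E3CuspFormCancellationU2Torus      -- ★ p861137 (K2E3-p32) the diagonal torus of `U(σ, Φ₂)`: `torus_rel`, `v_torus_last_eq_inv` (`|d₁| = |d₀|⁻¹`), `diag_mem_heightBall_iff` at `Fin 2`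
import HarnessLib

/-!
# h413 ∕ Track B «K2-LIT», (SC-an)₂ line, brick [M5](D2)₂: CONJUGATOR AND SUPPORT CONTROL AT RANK ONE — HARISH-CHANDRA'S THEOREM 18 AND ITS COROLLARY FOR THE
# DIAGONAL TORUS OF `U(σ, Φ₂)(K)`: `x t x⁻¹ ∈ Ω_m`, `t = diag(d₀, d₁)` regular with root value `|d₀ − d₁| ≥ |ϖ^λ|` ⟹ `∃ a ∈ T, x a ∈ Ω_{m+λ} ⊆ Ω_{2m+2λ}`
# (Harish-Chandra 1970, Part VII §2 Theorem 18 + Corollary p. 69; §3 p. 71 (ii); cf. Theorem 19 and Harish-Chandra 1957 Lemma 5)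

Cell `pub/hodgecm-mathlib`, crux H413 = `stmt-HodgeConjecture-24833`, route of record `HCCMUnconditional`; chair K2-lead (g2), LINE-LEAD∕dealer K2E3-plan (g4), architect
K2E3-p25 (g3); chain desk K2E3-p27 (g0), cone map K2E3-p33 (g0).  THEOREMS ONLY (no `def`, no `instance`, no `notation`, no named-fact hypothesis, no `sorry`); lane
`--supports stmt-HodgeConjecture-24833 --as helper`, count-neutral.

PURPOSE.  The (SC-an)₂ road (M5h₂) ports the `U(2,1)` engine of (SC-an) to `U(1,1)`.  Its bricks `K2E3TruncatedCharTorusSlicingTwo` ((M5b)₂, K2E3-p35), `K2E3Supercuspidal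
TruncatedCharRadiusDatumTwo` ([M6′]₂, K2E3-p36) and `K2E3SupercuspBallBoundSplitAssemblyTwo` ((M5e-1)₂) consume the two non-Theorem-20 HEIGHT CONTROLS of the domination weight
`W = c|D|^{−1∕2}(1+|λ|)^k`: the conjugator `y₀` of `g = y₀ t y₀⁻¹` ((D2a)) and the support bound of `f_t(x) = θ(x t x⁻¹)` ((D2b)), both of height LINEAR in `λ(t)`.  THIS FILE is
their `Fin 2` twin: the same print [HarishChandra1970, Part VII §2 p. 69] THEOREM 18 «`|D(γ)|^{r∕2}‖x̄‖ < c` if `γ^x ∈ ωZ`» + COROLLARY «`1 + σ(x̄) ≤ c(1 + |λ(γ)|)`» and p. 71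
(ii) «`σ(C_γ) ≤ c_γ(1+|λ(γ)|)`», at RANK ONE for `Γ = T = {d(α, σ(α)⁻¹)}` the diagonal torus of `U(σ, Φ₂)(K)` (Rogawski's `M` of `U(1,1)`), with EXPLICIT LINEAR constants.
Frame (verbatim the ★ (D2) ∕ ★ U2Torus frame): `K` a field with `Valued K ℤᵐ⁰`, `σ` isometric (and involutive where needed), `J = Φ₂`, a uniformiser `ϖ`, and the height-ball
membership of ★ p856390 (`g ∈ Ω_m ⟺ ϖ^m g, ϖ^m g⁻¹ integral`) as a HYPOTHESIS `hmem` on an abstract `Ω : ℕ → Set U`.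

WHAT CHANGES FROM `N = 3` (honest 2 × 2 algebra, not a `sed` port).  (i) LAGRANGE HAS ONE FACTOR: for `g = x t x⁻¹`, `t = diag(d)`, the spectral projector is
`x E_{jj} x⁻¹ = (g − d_{i′}) ∕ (d_j − d_{i′})` (`i′ = 1 − j` the other index) instead of `Π_{i≠j}(g − d_i) ∕ D_j`; so `t ∈ Ω_m` and `|d_j − d_{i′}| ≥ |ϖ^λ|` give the KEY BOUND
`|ϖ^{m+λ} · x_{aj} · (x⁻¹)_{jb}| ≤ 1`, and the honest radius is **`m + λ`** (half of `N = 3`'s `2m + 2λ`).  (ii) There is NO unit middle entry: `|d₁| = |d₀|⁻¹` (★ U2Torus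
`v_torus_last_eq_inv`), so `t ∈ Ω_m` already gives `|ϖ^m d_i| ≤ 1` for both `i` without `|ϖ^m| ≤ 1`, and the «middle column against itself» step of ★ (D2) §4a disappears —
column `1 = rev 0` is read against the maximal entry of column `0`.  (iii) The scaling torus element is `a = diag(α, σ(α)⁻¹)`, `α = x_{a₀0}⁻¹`.
CURRENCY.  So that the three consumers port their ★ `N = 3` binder bytes TOKEN-FOR-TOKEN (`Fin 3 ↦ Fin 2` only), the three consumed heads are exported TWICE: under the ★ names
with the ★ radius `Ω (2 * m + 2 * lam)` (from the sharp ones by `Ω`-monotonicity, §2), and under the same names suffixed `_sharp` with the honest radius `Ω (m + lam)`.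
* §1 the one generic matrix lemma `N = 2` needs beyond ★ (D2) §1: `mul_diagonal_mul_sub_smul_eq` (`X · diag(d) · Y − c = X · diag(d − c) · Y` when `Y X = 1`).
* §2 `heightBall_mono` (`k ≤ k′ ⇒ Ω_k ⊆ Ω_{k′}`, from `hmem` and `|ϖ| ≤ 1` alone); `coe_conj_torus`, `exists_apply_ne_zero`; **`mem_heightBall_torus_of_conj_mem`** (`x t x⁻¹ ∈ Ω_m ⇒ t ∈ Ω_m`).
* §3 **`v_pow_mul_apply_mul_apply_rev_le_one`** — THE KEY BOUND `|ϖ^{m+λ} · x_{aj} · x_{b, 1−j}| ≤ 1`.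
* §4 **`mem_heightBall_of_conj_mem_of_column_normalised`** (column `0` normalised ⇒ `x ∈ Ω_{m+λ}`), **`exists_mul_torusU_mem_heightBall_of_conj_mem_sharp`** (`∃ a ∈ T, x a ∈ Ω_{m+λ}`)
  and the currency form **`exists_mul_torusU_mem_heightBall_of_conj_mem`** (`… ∈ Ω_{2m+2λ}`) — THEOREM 18 ∕ COROLLARY at rank one.
* §5 the consumers' shapes, sharp and currency: **`exists_conjugator_mem_heightBall_sharp`** ∕ **`exists_conjugator_mem_heightBall`** ((D2a)₂: `g ∈ Ω_m`, `g = y t y⁻¹ ⇒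
  ∃ y₀ ∈ Ω_{m+λ}` resp. `Ω_{2m+2λ}`, `g = y₀ t y₀⁻¹`) and **`mem_heightBall_mul_torusU_of_conj_mem_support_sharp`** ∕ **`mem_heightBall_mul_torusU_of_conj_mem_support`** ((D2b)₂:
  `supp θ ⊆ Ω_{m_θ} ⇒ θ(x t x⁻¹) ≠ 0 → x ∈ Ω_{m_θ+λ} · T` resp. `Ω_{2m_θ+2λ} · T`).

HONEST LABEL.  HC_CM is proved only modulo the 7 printed citations (2 remaining named inputs: hLiu418 = `stmt-HodgeConjecture-24832`, h413 = `stmt-HodgeConjecture-24833`)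
until rung 0 closes; count-neutral helper (an intermediate of (SC-an)₂, not a printed citation of HC_CM); (SC-an)₂ is NOT ★ until the whole (M5h₂) chain lands.

## References
* [HarishChandra1970] Harish-Chandra (notes by G. van Dijk), *Harmonic Analysis on Reductive p-adic Groups*, LNM 162 (1970), Part VII §2 Theorem 18 and Corollary, Theorem 19
  p. 69; §3 p. 71 (ii); §7 pp. 77–80 (proof of Theorem 18).
* [HarishChandra1957] Harish-Chandra, *A formula for semisimple Lie groups*, Amer. J. Math. 79 (1957) 733–760, Lemma 5 p. 198 (the eigenvalue estimate behind Theorem 19).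
* [Rogawski1990] J. D. Rogawski, *Automorphic Representations of Unitary Groups in Three Variables*, Ann. of Math. Stud. 123 (1990), §1.9–§1.10 pp. 8–9, 13 (`U(1,1)`,
  `M = {d(α, ᾱ⁻¹)}`, `g⁻¹ = Φ ᵗ(σg) Φ`).
-/

set_option autoImplicit false
set_option linter.dupNamespace false  -- the mandated namespace repeats the single-problem summit's segment (`HodgeConjecture.HodgeConjecture`)

noncomputable section

open scoped MatrixGroups WithZero Pointwise
open Matrix
open Literature.NumberTheory.Automorphic Literature.NumberTheory.Automorphic.UnitaryGroup
open Summit.HodgeConjecture.HodgeConjecture.Cruxes.H413.K2E3CuspFormCancellationU2Torus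

namespace Summit.HodgeConjecture.HodgeConjecture.Cruxes.H413.K2E3ConjugatorHeightControlRankOneTwo

/-! ## §1 The one-factor Lagrange identity (generic) -/

section Generic

variable {K : Type*} [Field K] {n : Type*} [Fintype n] [DecidableEq n]

/-- **THE ONE-FACTOR LAGRANGE IDENTITY**: for `G = X · diag(d) · Y` with `Y X = 1`, `G − c = X · diag(d_i − c) · Y` (at `2 × 2` a single factor `g − d_{i′}` already isolates the
spectral projector `x E_{jj} x⁻¹`, cf. ★ (D2) `sub_smul_mul_sub_smul_eq` for the two-factor `3 × 3` case). [cite: HarishChandra1957, Lemma 5 p. 198] -/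
theorem mul_diagonal_mul_sub_smul_eq {X Y : Matrix n n K} (hYX : Y * X = 1) (d : n → K) (c : K) :
    X * diagonal d * Y - c • (1 : Matrix n n K) = X * diagonal (fun i => d i - c) * Y := by
  have hXY : X * Y = 1 := mul_eq_one_comm.1 hYX
  have hXY1 : c • (1 : Matrix n n K) = X * diagonal (fun _ => c) * Y := by
    rw [show (diagonal fun _ : n => c) = c • (1 : Matrix n n K) by rw [← diagonal_one, smul_eq_diagonal_mul]; simp,
      Matrix.mul_smul, Matrix.mul_one, Matrix.smul_mul, hXY]
  rw [hXY1, ← Matrix.sub_mul, ← Matrix.mul_sub, diagonal_sub]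

end Generic

/-! ## §2–§4 The diagonal torus of `U(σ, Φ₂)(K)`: Theorem 18 at rank one -/

section Torus

variable {K : Type*} [Field K] [Valued K ℤᵐ⁰] (σ : K →+* K) (hσv : ∀ x, Valued.v (σ x) = Valued.v x) (hσσ : ∀ x, σ (σ x) = x)
  {J : Matrix (Fin 2) (Fin 2) K} (hJ : J = (StdForm.antidiagonal 2).over K) {ϖ : K} (hϖ : Valued.v ϖ = WithZero.exp (-1 : ℤ))
  (Ω : ℕ → Set ↥(unitaryGroupOfForm σ J))
  (hmem : ∀ (m : ℕ) (g : ↥(unitaryGroupOfForm σ J)), g ∈ Ω m ↔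
    (∀ i j, Valued.v (ϖ ^ m * ((g : GL (Fin 2) K) : Matrix (Fin 2) (Fin 2) K) i j) ≤ 1) ∧
      ∀ i j, Valued.v (ϖ ^ m * (((g : GL (Fin 2) K)⁻¹ : GL (Fin 2) K) : Matrix (Fin 2) (Fin 2) K) i j) ≤ 1)

include hϖ hmem in
/-- **`Ω` IS MONOTONE**: `k ≤ k′ ⇒ Ω_k ⊆ Ω_{k′}` (`ϖ^{k′} g = ϖ^{k′−k} · ϖ^k g` with `|ϖ| ≤ 1`) — the bridge from the sharp `2 × 2` radius `m + λ` to the ★ `N = 3` currency `2m + 2λ`.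
[cite: HarishChandra1970, Part VII §2 p. 69] -/
theorem heightBall_mono {k k' : ℕ} (hkk' : k ≤ k') {g : ↥(unitaryGroupOfForm σ J)} (hg : g ∈ Ω k) : g ∈ Ω k' := by
  obtain ⟨hA, hB⟩ := (hmem k g).1 hg
  obtain ⟨j, rfl⟩ := Nat.exists_eq_add_of_le hkk'
  have hϖj : Valued.v (ϖ ^ j) ≤ 1 := by
    rw [CartanUnique.v_uniformizer_pow hϖ j, ← WithZero.exp_zero, WithZero.exp_le_exp]; omega
  have e : ϖ ^ (k + j) = ϖ ^ j * ϖ ^ k := by rw [pow_add, mul_comm]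
  refine (hmem (k + j) g).2 ⟨fun a b => ?_, fun a b => ?_⟩
  · rw [e, mul_assoc, map_mul]; exact mul_le_one' hϖj (hA a b)
  · rw [e, mul_assoc, map_mul]; exact mul_le_one' hϖj (hB a b)

omit [Valued K ℤᵐ⁰] in
/-- The matrices of `x t x⁻¹` and of its inverse for `t = diag d`: `X · diag(d) · X⁻¹` and `X · diag(d⁻¹) · X⁻¹`. [cite: Rogawski1990, §1.10 p. 9] -/
theorem coe_conj_torus {x t : ↥(unitaryGroupOfForm σ J)} {d : Fin 2 → Kˣ} (hd : glDiagonal 2 K d = (t : GL (Fin 2) K)) :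
    (((x * t * x⁻¹ : ↥(unitaryGroupOfForm σ J)) : GL (Fin 2) K) : Matrix (Fin 2) (Fin 2) K) =
        ((x : GL (Fin 2) K) : Matrix (Fin 2) (Fin 2) K) * diagonal (fun i => (d i : K)) * (((x : GL (Fin 2) K)⁻¹ : GL (Fin 2) K) : Matrix (Fin 2) (Fin 2) K) ∧
      ((((x * t * x⁻¹ : ↥(unitaryGroupOfForm σ J)) : GL (Fin 2) K)⁻¹ : GL (Fin 2) K) : Matrix (Fin 2) (Fin 2) K) =
        ((x : GL (Fin 2) K) : Matrix (Fin 2) (Fin 2) K) * diagonal (fun i => ((d i : K))⁻¹) * (((x : GL (Fin 2) K)⁻¹ : GL (Fin 2) K) : Matrix (Fin 2) (Fin 2) K) := by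
  refine ⟨?_, ?_⟩
  · rw [Subgroup.coe_mul, Subgroup.coe_mul, Subgroup.coe_inv, Units.val_mul, Units.val_mul, ← hd, coe_glDiagonal]
  · have e : ((x * t * x⁻¹ : ↥(unitaryGroupOfForm σ J)) : GL (Fin 2) K)⁻¹ = ((x * t⁻¹ * x⁻¹ : ↥(unitaryGroupOfForm σ J)) : GL (Fin 2) K) := by
      rw [← Subgroup.coe_inv]; congr 1; group
    rw [e, Subgroup.coe_mul, Subgroup.coe_mul, Subgroup.coe_inv, Subgroup.coe_inv, Units.val_mul, Units.val_mul, ← hd,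
      K2E3CuspFormCancellationU3Torus.coe_inv_glDiagonal]

omit [Valued K ℤᵐ⁰] in
/-- A column of an invertible matrix is non-zero. [cite: HarishChandra1957, Lemma 5 p. 198] -/
theorem exists_apply_ne_zero (x : ↥(unitaryGroupOfForm σ J)) (j : Fin 2) : ∃ a, ((x : GL (Fin 2) K) : Matrix (Fin 2) (Fin 2) K) a j ≠ 0 := by
  by_contra h
  push Not at h
  have h1 : ((((x : GL (Fin 2) K)⁻¹ : GL (Fin 2) K) : Matrix (Fin 2) (Fin 2) K) * ((x : GL (Fin 2) K) : Matrix (Fin 2) (Fin 2) K)) j j = 1 := by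
    rw [Units.inv_mul, Matrix.one_apply_eq]
  rw [Matrix.mul_apply, Finset.sum_eq_zero fun a _ => by rw [h a, mul_zero]] at h1
  exact zero_ne_one h1

include hσv hJ hmem in
/-- **§2 `x t x⁻¹ ∈ Ω_m ⇒ t ∈ Ω_m`** for `t = diag d ∈ T`: the eigenvalues `d₀^{±1}` of `g^{±1}` satisfy `|ϖ^m d₀^{±1}| ≤ 1` (★ (D2) `v_pow_mul_le_one_of_eigen` on column `0` of
`x`), and ★ U2Torus `diag_mem_heightBall_iff` (no `|ϖ^m| ≤ 1` needed at `N = 2`). [cite: HarishChandra1970, Part VII §2 p. 69] -/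
theorem mem_heightBall_torus_of_conj_mem {x t : ↥(unitaryGroupOfForm σ J)} {d : Fin 2 → Kˣ} (hd : glDiagonal 2 K d = (t : GL (Fin 2) K)) {m : ℕ}
    (hg : x * t * x⁻¹ ∈ Ω m) : t ∈ Ω m := by
  obtain ⟨hA, hB⟩ := (hmem m _).1 hg
  obtain ⟨hmat, hmatinv⟩ := coe_conj_torus σ hd (x := x)
  rw [hmat] at hA; rw [hmatinv] at hB
  set X := ((x : GL (Fin 2) K) : Matrix (Fin 2) (Fin 2) K) with hXdef
  set Xi := (((x : GL (Fin 2) K)⁻¹ : GL (Fin 2) K) : Matrix (Fin 2) (Fin 2) K) with hXidef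
  have hXiX : Xi * X = 1 := Units.inv_mul _
  have hcol := exists_apply_ne_zero σ x 0
  refine (diag_mem_heightBall_iff σ hσv hJ Ω hmem hd m).2 ⟨?_, ?_⟩
  · refine K2E3ConjugatorHeightControlRankOne.v_pow_mul_le_one_of_eigen (G := X * diagonal (fun i => (d i : K)) * Xi) (fun a => ?_) hA hcol
    rw [Matrix.mul_assoc, Matrix.mul_assoc, hXiX, Matrix.mul_one, mul_diagonal]
  · refine K2E3ConjugatorHeightControlRankOne.v_pow_mul_le_one_of_eigen (G := X * diagonal (fun i => ((d i : K))⁻¹) * Xi) (fun a => ?_) hB hcol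
    rw [Matrix.mul_assoc, Matrix.mul_assoc, hXiX, Matrix.mul_one, mul_diagonal]

include hσv hJ hmem in
/-- **§3 THE KEY BOUND** `|ϖ^{m+λ} · x_{aj} · x_{b, 1−j}| ≤ 1` for all `a, b, j`, when `x t x⁻¹ ∈ Ω_m` and `t = diag d` has root value `|d_i − d_k| ≥ |ϖ^λ|` (`i ≠ k`):
one-factor Lagrange `x E_{jj} x⁻¹ = (g − d_{i′}) ∕ (d_j − d_{i′})` (`i′ = 1 − j`), `|ϖ^m (g − d_{i′})| ≤ 1` entrywise (`t ∈ Ω_m`, `|d₁| = |d₀|⁻¹`), `|d_j − d_{i′}| ≥ |ϖ^λ|`, and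
`(x⁻¹)_{jb} = σ(x_{1−b,1−j})`.  The `2 × 2` exponent is `m + λ`, half of ★ (D2)'s `2m + 2λ`. [cite: HarishChandra1970, Part VII §2 Theorem 18 p. 69; §7 pp. 77–80]
[cite: HarishChandra1957, Lemma 5 p. 198] -/
theorem v_pow_mul_apply_mul_apply_rev_le_one {x t : ↥(unitaryGroupOfForm σ J)} {d : Fin 2 → Kˣ} (hd : glDiagonal 2 K d = (t : GL (Fin 2) K))
    {lam : ℕ} (hreg : ∀ i k : Fin 2, i ≠ k → Valued.v (ϖ ^ lam) ≤ Valued.v ((d i : K) - d k)) {m : ℕ} (hg : x * t * x⁻¹ ∈ Ω m) (a b j : Fin 2) :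
    Valued.v (ϖ ^ (m + lam) * (((x : GL (Fin 2) K) : Matrix (Fin 2) (Fin 2) K) a j * ((x : GL (Fin 2) K) : Matrix (Fin 2) (Fin 2) K) b j.rev)) ≤ 1 := by
  obtain ⟨hA, hB⟩ := (hmem m _).1 hg
  obtain ⟨hmat, hmatinv⟩ := coe_conj_torus σ hd (x := x)
  rw [hmat] at hA
  have htΩ := mem_heightBall_torus_of_conj_mem σ hσv hJ Ω hmem hd hg
  obtain ⟨ht0, ht0'⟩ := (diag_mem_heightBall_iff σ hσv hJ Ω hmem hd m).1 htΩ
  set X := ((x : GL (Fin 2) K) : Matrix (Fin 2) (Fin 2) K) with hXdef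
  set Xi := (((x : GL (Fin 2) K)⁻¹ : GL (Fin 2) K) : Matrix (Fin 2) (Fin 2) K) with hXidef
  have hXiX : Xi * X = 1 := Units.inv_mul _
  -- the scaled eigenvalues `|ϖ^m d_i| ≤ 1` (`|d₁| = |d₀|⁻¹`: no unit middle entry at `N = 2`)
  have hrel := torus_rel σ hJ hd
  have h1 : Valued.v (d 1 : K) = (Valued.v (d 0 : K))⁻¹ := v_torus_last_eq_inv σ hσv hrel
  have hdi : ∀ i : Fin 2, Valued.v (ϖ ^ m * (d i : K)) ≤ 1 := by
    intro i
    fin_cases i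
    · exact ht0
    · show Valued.v (ϖ ^ m * (d 1 : K)) ≤ 1
      rw [map_mul, h1, ← map_inv₀, ← map_mul]; exact ht0'
  -- the other index `i′ = 1 − j`
  obtain ⟨i', hi', hcov⟩ : ∃ i' : Fin 2, i' ≠ j ∧ ∀ i, i ≠ j → i = i' := by
    fin_cases j
    · exact ⟨1, by decide, by decide⟩
    · exact ⟨0, by decide, by decide⟩
  -- one-factor Lagrange: `G − d_{i′} = X · diag(d − d_{i′}) · Xi`, whose `(a, b')` entry is `X_{aj} (d_j − d_{i′}) Xi_{jb'}`
  set G := X * diagonal (fun i => (d i : K)) * Xi with hGdef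
  have hL := mul_diagonal_mul_sub_smul_eq hXiX (fun i => (d i : K)) (d i' : K)
  have hD : ∀ b', (G - (d i' : K) • (1 : Matrix (Fin 2) (Fin 2) K)) a b' = X a j * ((d j : K) - d i') * Xi j b' := by
    intro b'
    rw [hGdef, hL]
    exact K2E3ConjugatorHeightControlRankOne.mul_diagonal_mul_apply_of_support (fun i hij => by
      rw [hcov i hij, sub_self]) a b'
  -- `|ϖ^m| · |that entry| ≤ 1`
  have hP : ∀ b', Valued.v (ϖ ^ m * (X a j * ((d j : K) - d i') * Xi j b')) ≤ 1 := by
    intro b'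
    rw [← hD b']
    exact K2E3ConjugatorHeightControlRankOne.v_pow_mul_sub_smul_apply_le_one hA (hdi i') a b'
  -- `|d_j − d_{i′}| ≥ |ϖ^λ|`
  have hDj : Valued.v (ϖ ^ lam) ≤ Valued.v ((d j : K) - d i') := hreg j i' (Ne.symm hi')
  -- unitarity: `Xi j b' = σ (X (rev b') (rev j))`, take `b' = rev b`
  have hXi : Xi j b.rev = σ (X b j.rev) := by
    have hx : (x : GL (Fin 2) K) ∈ unitaryGroupOfForm σ ((StdForm.antidiagonal 2).over K) := by rw [← hJ]; exact x.2
    rw [hXidef, coe_inv_apply_of_mem_unitaryGroupOfForm_antidiagonal σ (N := 2) hx, Fin.rev_rev]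
  have key := hP b.rev
  rw [hXi] at key
  -- assemble: `v(ϖ^{m+λ} X_{aj} X_{b,rev j}) = v(ϖ^m) v(ϖ^λ) v(X_{aj}) v(X_{b,rev j}) ≤ v(ϖ^m) v(D) v(X_{aj}) v(Xi) ≤ 1`
  rw [pow_add, map_mul, map_mul, map_mul, mul_assoc]
  set D : K := (d j : K) - d i' with hDdef
  clear_value D
  have h3 : Valued.v (ϖ ^ lam) * (Valued.v (X a j) * Valued.v (X b j.rev)) ≤ Valued.v D * (Valued.v (X a j) * Valued.v (X b j.rev)) :=
    mul_le_mul' hDj le_rfl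
  have hkey : Valued.v (ϖ ^ m) * (Valued.v D * (Valued.v (X a j) * Valued.v (X b j.rev))) = Valued.v (ϖ ^ m * (X a j * D * σ (X b j.rev))) := by
    rw [map_mul, map_mul, map_mul, hσv, mul_left_comm (Valued.v D), mul_assoc (Valued.v (X a j))]
  calc Valued.v (ϖ ^ m) * (Valued.v (ϖ ^ lam) * (Valued.v (X a j) * Valued.v (X b j.rev)))
      ≤ Valued.v (ϖ ^ m) * (Valued.v D * (Valued.v (X a j) * Valued.v (X b j.rev))) := mul_le_mul' le_rfl h3
    _ = Valued.v (ϖ ^ m * (X a j * D * σ (X b j.rev))) := hkey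
    _ ≤ 1 := key

include hσv hJ hϖ hmem in
/-- **§4a THEOREM 18 AT RANK ONE, NORMALISED FORM**: if `x t x⁻¹ ∈ Ω_m`, `t = diag d` with root value `≥ |ϖ^λ|`, and column `0` of `x` has all entries of valuation `≤ 1` with
equality somewhere, then `x ∈ Ω_{m+λ}` (column `1 = rev 0` against the maximal entry of column `0`; `x⁻¹` by unitarity; no middle column at `N = 2`).
[cite: HarishChandra1970, Part VII §2 Theorem 18 p. 69] [cite: HarishChandra1957, Lemma 5 p. 198] -/
theorem mem_heightBall_of_conj_mem_of_column_normalised {x t : ↥(unitaryGroupOfForm σ J)} {d : Fin 2 → Kˣ} (hd : glDiagonal 2 K d = (t : GL (Fin 2) K))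
    {lam : ℕ} (hreg : ∀ i k : Fin 2, i ≠ k → Valued.v (ϖ ^ lam) ≤ Valued.v ((d i : K) - d k)) {m : ℕ} (hg : x * t * x⁻¹ ∈ Ω m)
    (hcol : ∀ a, Valued.v (((x : GL (Fin 2) K) : Matrix (Fin 2) (Fin 2) K) a 0) ≤ 1) {a₀ : Fin 2} (ha₀ : Valued.v (((x : GL (Fin 2) K) : Matrix (Fin 2) (Fin 2) K) a₀ 0) = 1) :
    x ∈ Ω (m + lam) := by
  set X := ((x : GL (Fin 2) K) : Matrix (Fin 2) (Fin 2) K) with hXdef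
  have key := v_pow_mul_apply_mul_apply_rev_le_one σ hσv hJ Ω hmem hd hreg hg
  have hϖk : Valued.v (ϖ ^ (m + lam)) ≤ 1 := by
    rw [CartanUnique.v_uniformizer_pow hϖ, ← WithZero.exp_zero, WithZero.exp_le_exp]; omega
  -- every entry of `X` is `≤ |ϖ|^{-(m+λ)}`
  have hX : ∀ a j, Valued.v (ϖ ^ (m + lam) * X a j) ≤ 1 := by
    intro a j
    fin_cases j
    · -- column 0
      show Valued.v (ϖ ^ (m + lam) * X a 0) ≤ 1
      rw [map_mul]; exact mul_le_one' hϖk (hcol a)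
    · -- column 1 against the maximal entry of column 0
      show Valued.v (ϖ ^ (m + lam) * X a 1) ≤ 1
      have h := key a a₀ 1
      have hrev : (1 : Fin 2).rev = 0 := by decide
      rw [hrev, ← mul_assoc, map_mul, ha₀, mul_one] at h
      exact h
  -- `x⁻¹` by unitarity
  have hx : (x : GL (Fin 2) K) ∈ unitaryGroupOfForm σ ((StdForm.antidiagonal 2).over K) := by rw [← hJ]; exact x.2
  refine (hmem _ x).2 ⟨hX, fun i j => ?_⟩
  rw [coe_inv_apply_of_mem_unitaryGroupOfForm_antidiagonal σ (N := 2) hx, map_mul, hσv, ← map_mul]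
  exact hX _ _

include hσv hσσ hJ hϖ hmem in
/-- **§4b THEOREM 18 + COROLLARY AT RANK ONE (HARISH-CHANDRA), EXPLICIT AND SHARP**: `x ∈ U(σ,Φ₂)(K)`, `t = diag d ∈ T` with root value `|d₀ − d₁| ≥ |ϖ^λ|`, and
`x t x⁻¹ ∈ Ω_m` ⟹ **`∃ a ∈ T, x a ∈ Ω_{m+λ}`** — print's `|D(γ)|^{r∕2} ‖x̄‖ ≤ c`, `1 + σ(x̄) ≤ c(1+|λ(γ)|)` with `r`, `c` explicit and linear (scale column `0` by
`a = diag(α, σ(α)⁻¹)`, `α = x_{a₀0}⁻¹` at a maximal entry; `a` commutes with `t`). [cite: HarishChandra1970, Part VII §2 Theorem 18 and Corollary p. 69]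
[cite: HarishChandra1957, Lemma 5 p. 198] [cite: Rogawski1990, §1.10 p. 9] -/
theorem exists_mul_torusU_mem_heightBall_of_conj_mem_sharp {x t : ↥(unitaryGroupOfForm σ J)} {d : Fin 2 → Kˣ} (hd : glDiagonal 2 K d = (t : GL (Fin 2) K))
    {lam : ℕ} (hreg : ∀ i k : Fin 2, i ≠ k → Valued.v (ϖ ^ lam) ≤ Valued.v ((d i : K) - d k)) {m : ℕ} (hg : x * t * x⁻¹ ∈ Ω m) :
    ∃ a ∈ torusU σ J, x * a ∈ Ω (m + lam) := by
  classical
  set X := ((x : GL (Fin 2) K) : Matrix (Fin 2) (Fin 2) K) with hXdef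
  -- a maximal entry `X_{a₀0} ≠ 0` of column 0
  obtain ⟨a₀, -, ha₀⟩ := Finset.exists_max_image Finset.univ (fun a => Valued.v (X a 0)) Finset.univ_nonempty
  have hne : X a₀ 0 ≠ 0 := by
    obtain ⟨a, ha⟩ := exists_apply_ne_zero σ x 0
    intro h0
    have := ha₀ a (Finset.mem_univ a)
    rw [h0, map_zero] at this
    exact ha ((Valuation.zero_iff _).1 (le_antisymm this zero_le))
  have hσne : σ (X a₀ 0) ≠ 0 := fun h => hne (by rw [← hσσ (X a₀ 0), h, map_zero])
  -- the scaling torus element `a = diag(α, σ(α)⁻¹)`, `α = X_{a₀0}⁻¹`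
  let dα : Fin 2 → Kˣ := ![(Units.mk0 _ hne)⁻¹, Units.mk0 _ hσne]
  have hd0 : (dα 0 : K) = (X a₀ 0)⁻¹ := by simp [dα]
  have hd1 : (dα 1 : K) = σ (X a₀ 0) := by simp [dα]
  have hU : glDiagonal 2 K dα ∈ unitaryGroupOfForm σ J := by
    rw [hJ, glDiagonal_mem_unitaryGroupOfForm_antidiagonal_iff σ 2 dα]
    intro i
    fin_cases i
    · show σ (dα (Fin.rev 0) : K) * (dα 0 : K) = 1
      rw [show Fin.rev (0 : Fin 2) = 1 by decide, hd1, hd0, hσσ, mul_inv_cancel₀ hne]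
    · show σ (dα (Fin.rev 1) : K) * (dα 1 : K) = 1
      rw [show Fin.rev (1 : Fin 2) = 0 by decide, hd0, hd1, map_inv₀, inv_mul_cancel₀ hσne]
  let a : ↥(unitaryGroupOfForm σ J) := ⟨glDiagonal 2 K dα, hU⟩
  have haT : a ∈ torusU σ J := (mem_torusU_iff a).2 ⟨dα, rfl⟩
  have htT : t ∈ torusU σ J := (mem_torusU_iff t).2 ⟨d, hd⟩
  refine ⟨a, haT, ?_⟩
  -- `(x a) t (x a)⁻¹ = x t x⁻¹` since `a t = t a`
  have hcomm : a * t = t * a := congrArg Subtype.val (torusU_mul_comm (σ := σ) (J := J) ⟨a, haT⟩ ⟨t, htT⟩)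
  have hg' : (x * a) * t * (x * a)⁻¹ ∈ Ω m := by
    have e : (x * a) * t * (x * a)⁻¹ = x * t * x⁻¹ := by
      rw [_root_.mul_inv_rev, mul_assoc x a t, hcomm]; group
    rw [e]; exact hg
  -- column 0 of `x a` is `X_{·0} · α`
  have hXa : ∀ b, (((x * a : ↥(unitaryGroupOfForm σ J)) : GL (Fin 2) K) : Matrix (Fin 2) (Fin 2) K) b 0 = X b 0 * (X a₀ 0)⁻¹ := by
    intro b
    rw [Subgroup.coe_mul, Units.val_mul]
    show (X * ((glDiagonal 2 K dα : GL (Fin 2) K) : Matrix (Fin 2) (Fin 2) K)) b 0 = X b 0 * (X a₀ 0)⁻¹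
    rw [coe_glDiagonal, mul_diagonal, hd0]
  have hv0 : Valued.v (X a₀ 0) ≠ 0 := (Valuation.ne_zero_iff _).2 hne
  refine mem_heightBall_of_conj_mem_of_column_normalised σ hσv hJ hϖ Ω hmem hd hreg hg' (fun b => ?_) (a₀ := a₀) ?_
  · rw [hXa, map_mul, map_inv₀]
    calc Valued.v (X b 0) * (Valued.v (X a₀ 0))⁻¹ ≤ Valued.v (X a₀ 0) * (Valued.v (X a₀ 0))⁻¹ := mul_le_mul' (ha₀ b (Finset.mem_univ b)) le_rfl
      _ = 1 := mul_inv_cancel₀ hv0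
  · rw [hXa, map_mul, map_inv₀, mul_inv_cancel₀ hv0]

include hσv hσσ hJ hϖ hmem in
/-- **§4b, ★ `N = 3` CURRENCY**: `x t x⁻¹ ∈ Ω_m`, `t = diag d` of root value `≥ |ϖ^λ|` ⟹ `∃ a ∈ T, x a ∈ Ω_{2m+2λ}` — the verbatim `Fin 3 ↦ Fin 2` twin of ★ (D2)
`exists_mul_torusU_mem_heightBall_of_conj_mem` (from the sharp radius `m + λ` by `Ω`-monotonicity). [cite: HarishChandra1970, Part VII §2 Theorem 18 and Corollary p. 69] -/
theorem exists_mul_torusU_mem_heightBall_of_conj_mem {x t : ↥(unitaryGroupOfForm σ J)} {d : Fin 2 → Kˣ} (hd : glDiagonal 2 K d = (t : GL (Fin 2) K))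
    {lam : ℕ} (hreg : ∀ i k : Fin 2, i ≠ k → Valued.v (ϖ ^ lam) ≤ Valued.v ((d i : K) - d k)) {m : ℕ} (hg : x * t * x⁻¹ ∈ Ω m) :
    ∃ a ∈ torusU σ J, x * a ∈ Ω (2 * m + 2 * lam) := by
  obtain ⟨a, haT, hxa⟩ := exists_mul_torusU_mem_heightBall_of_conj_mem_sharp σ hσv hσσ hJ hϖ Ω hmem hd hreg hg
  exact ⟨a, haT, heightBall_mono σ hϖ Ω hmem (by omega) hxa⟩

/-! ## §5 The two consumers' shapes: conjugator control and support control (sharp, and in the ★ `N = 3` currency) -/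

include hσv hσσ hJ hϖ hmem in
/-- **(D2a)₂ CONJUGATOR CONTROL, SHARP**: if `g = y t y⁻¹ ∈ Ω_m` with `t = diag d` of root value `≥ |ϖ^λ|`, then `g = y₀ t y₀⁻¹` for some `y₀ ∈ Ω_{m+λ}` (print p. 71: «choose
`y₀ ∈ yA` such that `1 + σ(y₀) ≤ c₀(1 + |λ(γ)|)`»). [cite: HarishChandra1970, Part VII §3 p. 71] -/
theorem exists_conjugator_mem_heightBall_sharp {g y t : ↥(unitaryGroupOfForm σ J)} {d : Fin 2 → Kˣ} (hd : glDiagonal 2 K d = (t : GL (Fin 2) K))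
    {lam : ℕ} (hreg : ∀ i k : Fin 2, i ≠ k → Valued.v (ϖ ^ lam) ≤ Valued.v ((d i : K) - d k)) {m : ℕ} (hgΩ : g ∈ Ω m) (hgy : g = y * t * y⁻¹) :
    ∃ y₀ : ↥(unitaryGroupOfForm σ J), y₀ ∈ Ω (m + lam) ∧ g = y₀ * t * y₀⁻¹ := by
  obtain ⟨a, haT, hya⟩ := exists_mul_torusU_mem_heightBall_of_conj_mem_sharp σ hσv hσσ hJ hϖ Ω hmem hd hreg (x := y) (by rw [← hgy]; exact hgΩ)
  have htT : t ∈ torusU σ J := (mem_torusU_iff t).2 ⟨d, hd⟩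
  have hcomm : a * t = t * a := congrArg Subtype.val (torusU_mul_comm (σ := σ) (J := J) ⟨a, haT⟩ ⟨t, htT⟩)
  refine ⟨y * a, hya, ?_⟩
  rw [hgy, _root_.mul_inv_rev, mul_assoc y a t, hcomm]; group

include hσv hσσ hJ hϖ hmem in
/-- **(D2a)₂ CONJUGATOR CONTROL, ★ `N = 3` CURRENCY**: if `g = y t y⁻¹ ∈ Ω_m` with `t = diag d` of root value `≥ |ϖ^λ|`, then `g = y₀ t y₀⁻¹` for some `y₀ ∈ Ω_{2m+2λ}` — the
verbatim `Fin 3 ↦ Fin 2` twin of ★ (D2) `exists_conjugator_mem_heightBall` (the `s = 2m + 2λ` of the Theorem-20 radius `R = m_C + (1 + 2s + 4m_C) + s`).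
[cite: HarishChandra1970, Part VII §3 p. 71] -/
theorem exists_conjugator_mem_heightBall {g y t : ↥(unitaryGroupOfForm σ J)} {d : Fin 2 → Kˣ} (hd : glDiagonal 2 K d = (t : GL (Fin 2) K))
    {lam : ℕ} (hreg : ∀ i k : Fin 2, i ≠ k → Valued.v (ϖ ^ lam) ≤ Valued.v ((d i : K) - d k)) {m : ℕ} (hgΩ : g ∈ Ω m) (hgy : g = y * t * y⁻¹) :
    ∃ y₀ : ↥(unitaryGroupOfForm σ J), y₀ ∈ Ω (2 * m + 2 * lam) ∧ g = y₀ * t * y₀⁻¹ := by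
  obtain ⟨y₀, hy₀, hgy₀⟩ := exists_conjugator_mem_heightBall_sharp σ hσv hσσ hJ hϖ Ω hmem hd hreg hgΩ hgy
  exact ⟨y₀, heightBall_mono σ hϖ Ω hmem (by omega) hy₀, hgy₀⟩

include hσv hσσ hJ hϖ hmem in
/-- **(D2b)₂ SUPPORT CONTROL, SHARP** (print p. 71 (ii) «`σ(C_γ) ≤ c_γ(1+|λ(γ)|)`»): if `θ` is supported in `Ω_{m_θ}` then `f_t(x) = θ(x t x⁻¹)` vanishes off `Ω_{m_θ+λ} · T` — so
`supp f_t ⊆ C·T` with `C := Ω_{m_θ + λ}` of radius LINEAR in `λ(t)`. [cite: HarishChandra1970, Part VII §3 p. 71] -/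
theorem mem_heightBall_mul_torusU_of_conj_mem_support_sharp {β : Type*} [Zero β] (θ : ↥(unitaryGroupOfForm σ J) → β) {mθ : ℕ} (hθ : ∀ g, θ g ≠ 0 → g ∈ Ω mθ)
    {t : ↥(unitaryGroupOfForm σ J)} {d : Fin 2 → Kˣ} (hd : glDiagonal 2 K d = (t : GL (Fin 2) K))
    {lam : ℕ} (hreg : ∀ i k : Fin 2, i ≠ k → Valued.v (ϖ ^ lam) ≤ Valued.v ((d i : K) - d k)) :
    ∀ x : ↥(unitaryGroupOfForm σ J), θ (x * t * x⁻¹) ≠ 0 → x ∈ Ω (mθ + lam) * ((torusU σ J : Subgroup ↥(unitaryGroupOfForm σ J)) : Set ↥(unitaryGroupOfForm σ J)) := by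
  intro x hx
  obtain ⟨a, haT, hxa⟩ := exists_mul_torusU_mem_heightBall_of_conj_mem_sharp σ hσv hσσ hJ hϖ Ω hmem hd hreg (hθ _ hx)
  exact Set.mem_mul.2 ⟨x * a, hxa, a⁻¹, (torusU σ J).inv_mem haT, by group⟩

include hσv hσσ hJ hϖ hmem in
/-- **(D2b)₂ SUPPORT CONTROL, ★ `N = 3` CURRENCY**: if `θ` is supported in `Ω_{m_θ}` then `f_t(x) = θ(x t x⁻¹)` vanishes off `Ω_{2m_θ+2λ} · T` — the verbatim `Fin 3 ↦ Fin 2`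
twin of ★ (D2) `mem_heightBall_mul_torusU_of_conj_mem_support`. [cite: HarishChandra1970, Part VII §3 p. 71] -/
theorem mem_heightBall_mul_torusU_of_conj_mem_support {β : Type*} [Zero β] (θ : ↥(unitaryGroupOfForm σ J) → β) {mθ : ℕ} (hθ : ∀ g, θ g ≠ 0 → g ∈ Ω mθ)
    {t : ↥(unitaryGroupOfForm σ J)} {d : Fin 2 → Kˣ} (hd : glDiagonal 2 K d = (t : GL (Fin 2) K))
    {lam : ℕ} (hreg : ∀ i k : Fin 2, i ≠ k → Valued.v (ϖ ^ lam) ≤ Valued.v ((d i : K) - d k)) :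
    ∀ x : ↥(unitaryGroupOfForm σ J), θ (x * t * x⁻¹) ≠ 0 → x ∈ Ω (2 * mθ + 2 * lam) * ((torusU σ J : Subgroup ↥(unitaryGroupOfForm σ J)) : Set ↥(unitaryGroupOfForm σ J)) := by
  intro x hx
  obtain ⟨a, haT, hxa⟩ := exists_mul_torusU_mem_heightBall_of_conj_mem σ hσv hσσ hJ hϖ Ω hmem hd hreg (hθ _ hx)
  exact Set.mem_mul.2 ⟨x * a, hxa, a⁻¹, (torusU σ J).inv_mem haT, by group⟩

end Torus

end Summit.HodgeConjecture.HodgeConjecture.Cruxes.H413.K2E3ConjugatorHeightControlRankOneTwo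

end
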